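import Summits.QuantumFields.YangMills.Theses.CheckerboardTriality

/-!
# Route `CheckerboardTriality`, support `CheckerboardCellsExist` (stmt-QuantumFields-22668) — the checkerboard period cells exist

Planner ym-idea-1 g8, LINE g8-B (split of `TrialityLimit`), «provable-now».  For every `L` we build a `ROT.PeriodCell 4` whose period
lattice is `(2L+1)·D₄` (`D₄` = even coordinate sum) and whose transversal contains the centred box `box 4 L`:
* `reps = box 4 L ∪ (box 4 L + (2L+1)·e₃)`;
* `red x` = the CENTRED reduction of every coordinate mod `M = 2L+1` (into `[−L, L]`), followed by the PARITY CORRECTION `+ M·e₃` when the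
  vector of quotients `q = (x − red₀ x)/M` has odd coordinate sum (then `x − red x = M·(q − e₃) ∈ M·D₄`).
The cell is assembled INLINE in the closing theorem (no new definitions); §1 is the one-coordinate integer arithmetic.

HONEST SCOPE.  Routine support of a draft sub-line (CheckerboardTriality g8-B) onto the R2d rung `BalabanLadder.ROT`; the cruxes
`TrialityOnCheckerboardCells` / `CheckerboardCoverTransfer` / `SexticClosure`, that rung and every summit statement stay open; nothing here bears on
the Yang–Mills mass gap. [cite: ConwaySloane1999, Ch. 4 §7.2 (the lattice D₄)]
-/

namespace Summit.QuantumFields.YangMills.Theorems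

namespace CheckerboardCells

open Finset
open Literature.Probability.LatticeModels (box Site mem_box)

/-! ## §1 Centred reduction modulo an odd number `M = 2L+1` -/

/-- The centred remainder `(a + L) mod (2L+1) − L` lies in `[−L, L]`. [folklore] -/
theorem cmod_bounds (L : ℕ) (a : ℤ) :
    -(L : ℤ) ≤ (a + L) % ((2 * L + 1 : ℕ) : ℤ) - L ∧ (a + L) % ((2 * L + 1 : ℕ) : ℤ) - L ≤ L := by
  have hM' : ((2 * L + 1 : ℕ) : ℤ) = 2 * (L : ℤ) + 1 := by push_cast; ring
  rw [hM']
  have h0 := Int.emod_nonneg (a + L) (b := 2 * (L : ℤ) + 1) (by omega)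
  have h1 := Int.emod_lt_of_pos (a + L) (b := 2 * (L : ℤ) + 1) (by omega)
  constructor <;> omega

/-- Decomposition `a = M·q + r` with the centred quotient `q = ⌊(a + L)/M⌋` and remainder `r`. [folklore] -/
theorem cmod_decomp (L : ℕ) (a : ℤ) :
    a = ((2 * L + 1 : ℕ) : ℤ) * ((a + L) / ((2 * L + 1 : ℕ) : ℤ)) + ((a + L) % ((2 * L + 1 : ℕ) : ℤ) - L) := by
  have := Int.mul_ediv_add_emod (a + (L : ℤ)) ((2 * L + 1 : ℕ) : ℤ)
  linarith

/-- Shifting by a multiple of `M` does not change the centred remainder. [folklore] -/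
theorem cmod_add_mul (L : ℕ) (a w : ℤ) :
    (a + ((2 * L + 1 : ℕ) : ℤ) * w + L) % ((2 * L + 1 : ℕ) : ℤ) - L = (a + L) % ((2 * L + 1 : ℕ) : ℤ) - L := by
  have : a + ((2 * L + 1 : ℕ) : ℤ) * w + L = (a + L) + ((2 * L + 1 : ℕ) : ℤ) * w := by ring
  rw [this, Int.add_mul_emod_self_left]

/-- Shifting by `M·w` shifts the centred quotient by `w`. [folklore] -/
theorem cquot_add_mul (L : ℕ) (a w : ℤ) :
    (a + ((2 * L + 1 : ℕ) : ℤ) * w + L) / ((2 * L + 1 : ℕ) : ℤ) = (a + L) / ((2 * L + 1 : ℕ) : ℤ) + w := by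
  have hM : ((2 * L + 1 : ℕ) : ℤ) ≠ 0 := by positivity
  have : a + ((2 * L + 1 : ℕ) : ℤ) * w + L = (a + L) + ((2 * L + 1 : ℕ) : ℤ) * w := by ring
  rw [this, Int.add_mul_ediv_left _ _ hM]

/-- On `[−L, L]` the centred remainder is the identity and the centred quotient vanishes. [folklore] -/
theorem cmod_of_mem (L : ℕ) {a : ℤ} (h₁ : -(L : ℤ) ≤ a) (h₂ : a ≤ L) :
    (a + L) % ((2 * L + 1 : ℕ) : ℤ) - L = a ∧ (a + L) / ((2 * L + 1 : ℕ) : ℤ) = 0 := by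
  have h0 : 0 ≤ a + L := by omega
  have hlt : a + L < ((2 * L + 1 : ℕ) : ℤ) := by push_cast; omega
  rw [Int.emod_eq_of_lt h0 hlt, Int.ediv_eq_zero_of_lt h0 hlt]
  constructor <;> omega

end CheckerboardCells

open Finset
open Literature.Probability.LatticeModels (box Site mem_box)
open CheckerboardCells

/-- **The route decl `CheckerboardTriality.CheckerboardCellsExist` (stmt-QuantumFields-22668) holds**: for every `L` there is a period cell of
`ℤ⁴` with period lattice `(2L+1)·D₄` whose transversal `box 4 L ∪ (box 4 L + (2L+1)e₃)` contains the centred box; reduction = centred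
reduction mod `2L+1` followed by the parity correction along `e₃`. [cite: ConwaySloane1999, Ch. 4 §7.2 (the lattice D₄)] -/
theorem checkerboardTriality_checkerboardCellsExist_proof :
    Summit.QuantumFields.YangMills.Theses.CheckerboardTriality.CheckerboardCellsExist := by
  unfold Summit.QuantumFields.YangMills.Theses.CheckerboardTriality.CheckerboardCellsExist
  intro L
  classical
  -- notation-free abbreviations (all `set`s are local to this proof)
  set M : ℤ := ((2 * L + 1 : ℕ) : ℤ) with hMdef
  have hM0 : M ≠ 0 := by rw [hMdef]; positivity
  set e₃ : Fin 4 → ℤ := Pi.single (3 : Fin 4) (1 : ℤ) with he₃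
  have hsum_e₃ : ∑ i, e₃ i = 1 := by simp [he₃, Finset.sum_pi_single']
  -- centred remainder / quotient vectors
  set cr : (Fin 4 → ℤ) → (Fin 4 → ℤ) := fun x i => (x i + L) % M - L with hcr
  set cq : (Fin 4 → ℤ) → (Fin 4 → ℤ) := fun x i => (x i + L) / M with hcq
  have hcr_mem : ∀ x, cr x ∈ box 4 L := by
    intro x
    rw [mem_box]
    intro i
    exact cmod_bounds L (x i)
  have hdecomp : ∀ x i, x i = M * cq x i + cr x i := fun x i => cmod_decomp L (x i)
  -- the period lattice `M·D₄` as an additive subgroup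
  let P : AddSubgroup (Fin 4 → ℤ) :=
    { carrier := {z | ∃ w : Fin 4 → ℤ, Even (∑ i, w i) ∧ z = ((2 * L + 1 : ℕ) : ℤ) • w}
      add_mem' := by
        rintro _ _ ⟨w₁, hw₁, rfl⟩ ⟨w₂, hw₂, rfl⟩
        refine ⟨w₁ + w₂, ?_, by rw [smul_add]⟩
        simpa [Finset.sum_add_distrib] using hw₁.add hw₂
      zero_mem' := ⟨0, by simp, by simp⟩
      neg_mem' := by
        rintro _ ⟨w, hw, rfl⟩
        refine ⟨-w, ?_, by rw [smul_neg]⟩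
        simpa [Finset.sum_neg_distrib] using hw.neg }
  have hPmem : ∀ z : Fin 4 → ℤ, z ∈ P ↔ ∃ w : Fin 4 → ℤ, Even (∑ i, w i) ∧ z = M • w := fun z => Iff.rfl
  -- the reduction
  let red : (Fin 4 → ℤ) → (Fin 4 → ℤ) := fun x => if Even (∑ i, cq x i) then cr x else cr x + M • e₃
  have hred_even : ∀ x, Even (∑ i, cq x i) → red x = cr x := fun x h => if_pos h
  have hred_odd : ∀ x, ¬ Even (∑ i, cq x i) → red x = cr x + M • e₃ := fun x h => if_neg h
  -- shifting by a period: remainders unchanged, quotients shifted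
  have hshift : ∀ (x w : Fin 4 → ℤ), cr (x + M • w) = cr x ∧ cq (x + M • w) = cq x + w := by
    intro x w
    constructor
    · funext i
      simp only [hcr, Pi.add_apply, Pi.smul_apply, smul_eq_mul]
      exact cmod_add_mul L (x i) (w i)
    · funext i
      simp only [hcq, Pi.add_apply, Pi.smul_apply, smul_eq_mul]
      exact cquot_add_mul L (x i) (w i)
  refine ⟨{ P := P
            reps := box 4 L ∪ (box 4 L).image (fun y => y + M • e₃)
            red := red
            red_mem := ?_
            red_eq_self := ?_
            red_sub_mem := ?_
            red_add := ?_ }, rfl, Finset.subset_union_left⟩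
  · -- red_mem
    intro x
    by_cases h : Even (∑ i, cq x i)
    · rw [hred_even x h]
      exact Finset.mem_union_left _ (hcr_mem x)
    · rw [hred_odd x h]
      exact Finset.mem_union_right _ (Finset.mem_image.mpr ⟨cr x, hcr_mem x, rfl⟩)
  · -- red_eq_self
    intro x hx
    rcases Finset.mem_union.mp hx with hx | hx
    · rw [mem_box] at hx
      have hcrx : cr x = x := funext fun i => (cmod_of_mem L (hx i).1 (hx i).2).1
      have hcqx : ∀ i, cq x i = 0 := fun i => (cmod_of_mem L (hx i).1 (hx i).2).2
      have hev : Even (∑ i, cq x i) := by simp [hcqx]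
      rw [hred_even x hev, hcrx]
    · obtain ⟨y, hy, rfl⟩ := Finset.mem_image.mp hx
      rw [mem_box] at hy
      have hcry : cr y = y := funext fun i => (cmod_of_mem L (hy i).1 (hy i).2).1
      have hcqy : cq y = 0 := funext fun i => (cmod_of_mem L (hy i).1 (hy i).2).2
      obtain ⟨h1, h2⟩ := hshift y e₃
      have hodd : ¬ Even (∑ i, cq (y + M • e₃) i) := by
        rw [h2, hcqy, zero_add, hsum_e₃]; decide
      rw [hred_odd _ hodd, h1, hcry]
  · -- red_sub_mem
    intro x
    show red x - x ∈ P
    rw [hPmem]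
    by_cases h : Even (∑ i, cq x i)
    · refine ⟨-cq x, ?_, ?_⟩
      · simpa [Finset.sum_neg_distrib] using h.neg
      · rw [hred_even x h]
        funext i
        simp only [Pi.sub_apply, Pi.smul_apply, Pi.neg_apply, smul_eq_mul]
        have := hdecomp x i
        linarith
    · refine ⟨-cq x + e₃, ?_, ?_⟩
      · have hodd : Odd (∑ i, cq x i) := Int.not_even_iff_odd.mp h
        have : ∑ i, (-cq x + e₃) i = -(∑ i, cq x i) + 1 := by
          simp only [Pi.add_apply, Pi.neg_apply, Finset.sum_add_distrib, Finset.sum_neg_distrib, hsum_e₃]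
        rw [this]
        exact hodd.neg.add_one
      · rw [hred_odd x h]
        funext i
        simp only [Pi.sub_apply, Pi.add_apply, Pi.smul_apply, Pi.neg_apply, smul_eq_mul]
        have := hdecomp x i
        linarith
  · -- red_add
    intro x p hp
    obtain ⟨w, hw, rfl⟩ := (hPmem p).mp hp
    obtain ⟨h1, h2⟩ := hshift x w
    have hpar : Even (∑ i, cq (x + M • w) i) ↔ Even (∑ i, cq x i) := by
      rw [h2]
      simp only [Pi.add_apply, Finset.sum_add_distrib]
      rw [Int.even_add]
      exact iff_true_right hw
    by_cases h : Even (∑ i, cq x i)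
    · rw [hred_even _ (hpar.mpr h), hred_even x h, h1]
    · rw [hred_odd _ (fun h' => h (hpar.mp h')), hred_odd x h, h1]

end Summit.QuantumFields.YangMills.Theorems
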